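import Summits.PneNP.PneNP.Theorems.KarlinRubinMonotoneBlindCnf

/-!
# Route KarlinRubin, crux `MonotoneBlind` (stmt-PneNP-18027): depth 3 — the structure events (counting)

Step 1 and the "big white clause" event of the depth-3 rescue lemma (seat write-up `MonotoneBlind_depth3_theorem.md`).
A clause `S` *needs rescue* for `(A, x)` if it has no on-slot of `x` outside `A`; its *inside part* is
`S.filter (inside A)`. With parameters `L'` (clause-size cutoff, `2L'` = "big"), `v₀` (vertex cutoff):

* `depth3_bad_split` — if a clause needing rescue has `> C(v₀-1,2)` slots inside `A` then either it is big, or it is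
  small and meets `A` in `≥ v₀` vertices;
* `depth3_card_kSubsets_bad₂_mul_le` — planted sets meeting some small clause in `≥ v₀` vertices:
  `# · n^{v₀} ≤ #𝓒 · #kSubsets · (4 L' d)^{v₀}`;
* `depth3_sqrt_le_card_inter` — a big clause needing rescue with `≤ L'` off-slots outside `A` meets `A` in
  `≥ ⌊√#S⌋` vertices; `depth3_card_rescue_mul_le` — otherwise `Pr_x[S needs rescue] ≤ 2^{-(L'+1)}`;
* `depth3_card_allOff_mul_le` — `Pr_x[S entirely off] ≤ 2^{-#S}`;
* `depth3_choose_mul_pow_le` — the numeric bound `C(2s, a) d^a n^{2c+2} ≤ n^a` for `a = ⌊√s⌋ ≤ d`, `2L' ≤ s`,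
  under `M² ≤ 2L'`, `18 d² ≤ n`, `(18 d²)^M n^{2c+2} ≤ n^M`.

All `--supports stmt-PneNP-18027`; no definitions.
-/

set_option linter.dupNamespace false -- `Summit.PneNP.PneNP.…`: summit = sub-problem (D-0017)

namespace Summit.PneNP.PneNP.Theorems

open Finset
open Literature.Computability.Complexity
open Literature.Probability.RandomGraphs.PlantedClique

variable {n : ℕ}

/-! ### Splitting the bad event -/

/-- **Bad inside parts come from big clauses or from many vertices in `A`.** If a clause `S` has more than `C(v₀-1,2)`
slots inside `A` then `2L' ≤ #S`, or `#S < 2L'` and `A` meets the vertices of `S` in at least `v₀` vertices.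
[folklore] -/
theorem depth3_bad_split (A : Finset (Fin n)) (S : Finset (⊤ : SimpleGraph (Fin n)).edgeSet) (L' v₀ : ℕ)
    (h : (v₀ - 1).choose 2 < #(S.filter fun e : (⊤ : SimpleGraph (Fin n)).edgeSet => ∀ v ∈ (e : Sym2 (Fin n)), v ∈ A)) :
    2 * L' ≤ #S ∨ (#S < 2 * L' ∧ v₀ ≤ #(A ∩ univ.filter fun v : Fin n => ∃ e ∈ S, v ∈ (e : Sym2 (Fin n)))) := by
  by_cases hbig : 2 * L' ≤ #S
  · exact Or.inl hbig
  · refine Or.inr ⟨not_le.1 hbig, ?_⟩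
    by_contra hlt
    have hle : #(A ∩ univ.filter fun v : Fin n => ∃ e ∈ S, v ∈ (e : Sym2 (Fin n))) ≤ v₀ - 1 := by omega
    exact absurd ((card_filter_inside_le_choose A S).trans (Nat.choose_le_choose 2 hle)) (not_le.2 h)

/-! ### Bad₂: small clauses with many vertices in `A` -/

/-- **Planted sets meeting a small clause in many vertices.** `#{A ∈ kSubsets : some S ∈ 𝓒 with #S < 2L' has
|A ∩ V(S)| ≥ v₀} · n^{v₀} ≤ #𝓒 · #kSubsets · (4 L' d)^{v₀}` (`d = min k n`): union bound over the clauses and the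
hypergeometric tail `card_kSubsets_filter_le_card_inter_mul_le`, with `C(|V(S)|, v₀) ≤ (4L')^{v₀}`. [folklore] -/
theorem depth3_card_kSubsets_bad₂_mul_le (𝓒 : Finset (Finset (⊤ : SimpleGraph (Fin n)).edgeSet)) (k L' v₀ : ℕ) :
    #((kSubsets n k).filter fun A => ∃ S ∈ 𝓒, #S < 2 * L' ∧
        v₀ ≤ #(A ∩ univ.filter fun v : Fin n => ∃ e ∈ S, v ∈ (e : Sym2 (Fin n)))) * n ^ v₀ ≤
      #𝓒 * (#(kSubsets n k) * (4 * L' * min k n) ^ v₀) := by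
  classical
  set V : Finset (⊤ : SimpleGraph (Fin n)).edgeSet → Finset (Fin n) :=
    fun S => univ.filter fun v : Fin n => ∃ e ∈ S, v ∈ (e : Sym2 (Fin n)) with hV
  have hcover : ((kSubsets n k).filter fun A => ∃ S ∈ 𝓒, #S < 2 * L' ∧ v₀ ≤ #(A ∩ V S)) ⊆
      (𝓒.filter fun S => #S < 2 * L').biUnion fun S => (kSubsets n k).filter fun A => v₀ ≤ #(A ∩ V S) := by
    intro A hA
    rw [mem_filter] at hA
    obtain ⟨hAk, S, hS, hsmall, hv⟩ := hA
    exact mem_biUnion.2 ⟨S, mem_filter.2 ⟨hS, hsmall⟩, mem_filter.2 ⟨hAk, hv⟩⟩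
  have hterm : ∀ S ∈ 𝓒.filter (fun S => #S < 2 * L'),
      #((kSubsets n k).filter fun A => v₀ ≤ #(A ∩ V S)) * n ^ v₀ ≤ #(kSubsets n k) * (4 * L' * min k n) ^ v₀ := by
    intro S hS
    have hsmall := (mem_filter.1 hS).2
    refine (card_kSubsets_filter_le_card_inter_mul_le (V S) k v₀).trans (Nat.mul_le_mul_left _ ?_)
    have hVle : #(V S) ≤ 4 * L' := (card_vertices_le_two_mul_card S).trans (by omega)
    calc (#(V S)).choose v₀ * (min k n) ^ v₀ ≤ (#(V S)) ^ v₀ * (min k n) ^ v₀ :=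
          Nat.mul_le_mul_right _ (Nat.choose_le_pow _ _)
      _ ≤ (4 * L') ^ v₀ * (min k n) ^ v₀ := Nat.mul_le_mul_right _ (Nat.pow_le_pow_left hVle _)
      _ = (4 * L' * min k n) ^ v₀ := by rw [← mul_pow]
  calc #((kSubsets n k).filter fun A => ∃ S ∈ 𝓒, #S < 2 * L' ∧ v₀ ≤ #(A ∩ V S)) * n ^ v₀
      ≤ #((𝓒.filter fun S => #S < 2 * L').biUnion fun S => (kSubsets n k).filter fun A => v₀ ≤ #(A ∩ V S)) *
          n ^ v₀ := Nat.mul_le_mul_right _ (card_le_card hcover)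
    _ ≤ (∑ S ∈ 𝓒.filter (fun S => #S < 2 * L'), #((kSubsets n k).filter fun A => v₀ ≤ #(A ∩ V S))) * n ^ v₀ :=
        Nat.mul_le_mul_right _ card_biUnion_le
    _ = ∑ S ∈ 𝓒.filter (fun S => #S < 2 * L'), #((kSubsets n k).filter fun A => v₀ ≤ #(A ∩ V S)) * n ^ v₀ :=
        sum_mul _ _ _
    _ ≤ ∑ _S ∈ 𝓒.filter (fun S => #S < 2 * L'), #(kSubsets n k) * (4 * L' * min k n) ^ v₀ := sum_le_sum hterm
    _ = #(𝓒.filter fun S => #S < 2 * L') * (#(kSubsets n k) * (4 * L' * min k n) ^ v₀) := by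
        rw [sum_const, smul_eq_mul]
    _ ≤ #𝓒 * (#(kSubsets n k) * (4 * L' * min k n) ^ v₀) :=
        Nat.mul_le_mul_right _ (card_le_card (filter_subset _ _))

/-! ### Bad₁: big clauses needing rescue -/

/-- **Few off-slots outside `A` force many vertices inside `A`.** If `2L' ≤ #S` and at most `L'` slots of `S` are
not inside `A`, then `A` meets the vertices of `S` in at least `⌊√#S⌋` vertices: the `≥ #S - L' ≥ #S/2` slots inside
`A` are `2`-subsets of `A ∩ V(S)`, so `q(q-1) ≥ #S` for `q = |A ∩ V(S)|`. [folklore] -/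
theorem depth3_sqrt_le_card_inter (A : Finset (Fin n)) (S : Finset (⊤ : SimpleGraph (Fin n)).edgeSet) (L' : ℕ)
    (hbig : 2 * L' ≤ #S)
    (hfew : #(S.filter fun e : (⊤ : SimpleGraph (Fin n)).edgeSet => ¬ ∀ v ∈ (e : Sym2 (Fin n)), v ∈ A) ≤ L') :
    Nat.sqrt #S ≤ #(A ∩ univ.filter fun v : Fin n => ∃ e ∈ S, v ∈ (e : Sym2 (Fin n))) := by
  set q := #(A ∩ univ.filter fun v : Fin n => ∃ e ∈ S, v ∈ (e : Sym2 (Fin n))) with hq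
  have hsplit := card_filter_not_inside_eq A S
  have hins := card_filter_inside_le_choose A S
  rw [← hq] at hins
  -- `#S - L' ≤ C(q, 2)`
  have h1 : #S ≤ q.choose 2 + L' := by omega
  have h2 : q.choose 2 * 2 = q * (q - 1) := by
    rw [Nat.choose_two_right, Nat.div_mul_cancel]
    exact (Nat.even_mul_pred_self q).two_dvd
  have h3 : #S ≤ q * q := by
    have : #S * 2 ≤ q.choose 2 * 2 + L' * 2 := by omega
    rw [h2] at this
    have hqq : q * (q - 1) ≤ q * q := Nat.mul_le_mul_left _ (Nat.sub_le _ _)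
    omega
  exact (Nat.sqrt_le_sqrt h3).trans_eq (Nat.sqrt_eq q)

/-- **A clause needs rescue with probability `2^{-#(off-slots)}`**: `#{x : S needs rescue for (A,x)} · 2^{#D} ≤ 2^{#slots}`
where `D` are the slots of `S` not inside `A` (they must all be off). [folklore] -/
theorem depth3_card_rescue_mul_le (A : Finset (Fin n)) (S : Finset (⊤ : SimpleGraph (Fin n)).edgeSet) :
    #(univ.filter fun x : EdgeVec n => ∀ e ∈ S, (¬ ∀ v ∈ (e : Sym2 (Fin n)), v ∈ A) → x e = false) *
        2 ^ #(S.filter fun e : (⊤ : SimpleGraph (Fin n)).edgeSet => ¬ ∀ v ∈ (e : Sym2 (Fin n)), v ∈ A) ≤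
      2 ^ Fintype.card (⊤ : SimpleGraph (Fin n)).edgeSet := by
  classical
  set D := S.filter fun e : (⊤ : SimpleGraph (Fin n)).edgeSet => ¬ ∀ v ∈ (e : Sym2 (Fin n)), v ∈ A with hD
  have hset : (univ.filter fun x : EdgeVec n => ∀ e ∈ S, (¬ ∀ v ∈ (e : Sym2 (Fin n)), v ∈ A) → x e = false) =
      univ.filter fun x : EdgeVec n => ∀ e ∈ D, x e = false := by
    ext x
    simp only [mem_filter, mem_univ, true_and, hD]
    constructor
    · intro h e he; exact h e he.1 he.2
    · intro h e he hne; exact h e ⟨he, hne⟩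
  rw [hset]
  exact card_filter_forall_eq_false_mul_le D

/-- **Big clauses needing rescue, per planted set.** For `2L' ≤ #S`: either `A` meets `V(S)` in `≥ ⌊√#S⌋` vertices, or
`#{x : S needs rescue} · 2^{L'+1} ≤ 2^{#slots}`. [folklore] -/
theorem depth3_rescue_dichotomy (A : Finset (Fin n)) (S : Finset (⊤ : SimpleGraph (Fin n)).edgeSet) (L' : ℕ)
    (hbig : 2 * L' ≤ #S) :
    Nat.sqrt #S ≤ #(A ∩ univ.filter fun v : Fin n => ∃ e ∈ S, v ∈ (e : Sym2 (Fin n))) ∨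
      #(univ.filter fun x : EdgeVec n => ∀ e ∈ S, (¬ ∀ v ∈ (e : Sym2 (Fin n)), v ∈ A) → x e = false) *
          2 ^ (L' + 1) ≤ 2 ^ Fintype.card (⊤ : SimpleGraph (Fin n)).edgeSet := by
  by_cases hfew : #(S.filter fun e : (⊤ : SimpleGraph (Fin n)).edgeSet => ¬ ∀ v ∈ (e : Sym2 (Fin n)), v ∈ A) ≤ L'
  · exact Or.inl (depth3_sqrt_le_card_inter A S L' hbig hfew)
  · refine Or.inr (le_trans (Nat.mul_le_mul_left _ (Nat.pow_le_pow_right two_pos ?_)) (depth3_card_rescue_mul_le A S))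
    omega

/-! ### Bad₃: big clauses entirely off -/

/-- **A clause is entirely off with probability `2^{-#S}`.** [folklore] -/
theorem depth3_card_allOff_mul_le (S : Finset (⊤ : SimpleGraph (Fin n)).edgeSet) :
    #(univ.filter fun x : EdgeVec n => ∀ e ∈ S, x e = false) * 2 ^ #S ≤
      2 ^ Fintype.card (⊤ : SimpleGraph (Fin n)).edgeSet := by
  classical
  exact card_filter_forall_eq_false_mul_le S

/-! ### The numeric bound for Bad₁ -/

/-- `C(2s, a) ≤ (18 a)^a` for `a = ⌊√s⌋`: `C(2s,a) · a! ≤ (2s)^a ≤ (6a²)^a` and `a^a ≤ 3^a a!`. [folklore] -/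
theorem choose_two_mul_sqrt_le (s : ℕ) : (2 * s).choose (Nat.sqrt s) ≤ (18 * Nat.sqrt s) ^ Nat.sqrt s := by
  set a := Nat.sqrt s with ha
  have hs : s < (a + 1) * (a + 1) := Nat.lt_succ_sqrt s
  -- `a^a ≤ 3^a · a!` (from the real-analytic bound)
  have hfac : a ^ a ≤ 3 ^ a * a.factorial := by
    have h := pow_self_le_three_pow_mul_factorial a
    exact_mod_cast h
  -- `C(2s, a) · a! ≤ (2s)^a`
  have hdesc : (2 * s).choose a * a.factorial ≤ (2 * s) ^ a := by
    rw [mul_comm, ← Nat.descFactorial_eq_factorial_mul_choose]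
    exact Nat.descFactorial_le_pow _ _
  rcases Nat.eq_zero_or_pos a with h0 | hpos
  · rw [h0]; simp
  have h2s : 2 * s ≤ 6 * a * a := by nlinarith
  have hmain : (2 * s).choose a * a.factorial ≤ (18 * a) ^ a * a.factorial := by
    calc (2 * s).choose a * a.factorial ≤ (2 * s) ^ a := hdesc
      _ ≤ (6 * a * a) ^ a := Nat.pow_le_pow_left h2s _
      _ = 6 ^ a * a ^ a * a ^ a := by rw [mul_pow, mul_pow]
      _ ≤ 6 ^ a * a ^ a * (3 ^ a * a.factorial) := Nat.mul_le_mul_left _ hfac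
      _ = (18 * a) ^ a * a.factorial := by
          rw [show (18 : ℕ) = 6 * 3 by norm_num, mul_pow, mul_pow]; ring
  exact Nat.le_of_mul_le_mul_right hmain a.factorial_pos

/-- **Numeric bound for Bad₁.** For `2L' ≤ s`, `a = ⌊√s⌋ ≤ d`, under `M·M ≤ 2L'`, `18 d² ≤ n` and
`(18 d²)^M · n^{2c+2} ≤ n^M`: `C(2s, a) · d^a · n^{2c+2} ≤ n^a`. [folklore] -/
theorem depth3_choose_mul_pow_le {s d L' M c : ℕ} (hbig : 2 * L' ≤ s) (had : Nat.sqrt s ≤ d)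
    (H2 : M * M ≤ 2 * L') (H3 : 18 * (d * d) ≤ n) (H4 : (18 * (d * d)) ^ M * n ^ (2 * c + 2) ≤ n ^ M) :
    (2 * s).choose (Nat.sqrt s) * d ^ Nat.sqrt s * n ^ (2 * c + 2) ≤ n ^ Nat.sqrt s := by
  set a := Nat.sqrt s with ha
  have hMa : M ≤ a := by
    rw [ha, Nat.le_sqrt]
    exact H2.trans hbig
  have hstep1 : (2 * s).choose a * d ^ a ≤ (18 * (d * d)) ^ a := by
    calc (2 * s).choose a * d ^ a ≤ (18 * a) ^ a * d ^ a :=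
          Nat.mul_le_mul_right _ (choose_two_mul_sqrt_le s)
      _ = (18 * a * d) ^ a := by rw [← mul_pow]
      _ ≤ (18 * (d * d)) ^ a := by
          refine Nat.pow_le_pow_left ?_ _
          calc 18 * a * d ≤ 18 * d * d := Nat.mul_le_mul_right _ (Nat.mul_le_mul_left _ had)
            _ = 18 * (d * d) := by ring
  have hsplit : (18 * (d * d)) ^ a = (18 * (d * d)) ^ (a - M) * (18 * (d * d)) ^ M := by
    rw [← pow_add, Nat.sub_add_cancel hMa]
  calc (2 * s).choose a * d ^ a * n ^ (2 * c + 2)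
      ≤ (18 * (d * d)) ^ a * n ^ (2 * c + 2) := Nat.mul_le_mul_right _ hstep1
    _ = (18 * (d * d)) ^ (a - M) * ((18 * (d * d)) ^ M * n ^ (2 * c + 2)) := by rw [hsplit, mul_assoc]
    _ ≤ n ^ (a - M) * n ^ M := Nat.mul_le_mul (Nat.pow_le_pow_left H3 _) H4
    _ = n ^ a := by rw [← pow_add, Nat.sub_add_cancel hMa]

/-! ### Registered form -/

/-- **stub_depth3Bad** (registered side result of stmt-PneNP-18027, depth-3 line of seat 0; NOT a stub of the
picked line's composition). [folklore] -/
theorem stub_depth3Bad : ∀ (n : ℕ) (𝓒 : Finset (Finset ((⊤ : SimpleGraph (Fin n)).edgeSet))) (k L' v₀ : ℕ), ((kSubsets n k).filter fun A => ∃ S ∈ 𝓒, S.card < 2 * L' ∧ v₀ ≤ (A ∩ Finset.univ.filter fun v : Fin n => ∃ e ∈ S, v ∈ (e : Sym2 (Fin n))).card).card * n ^ v₀ ≤ 𝓒.card * ((kSubsets n k).card * (4 * L' * min k n) ^ v₀) :=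
  fun _ 𝓒 k L' v₀ => depth3_card_kSubsets_bad₂_mul_le 𝓒 k L' v₀

end Summit.PneNP.PneNP.Theorems
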